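import Mathlib

/-!
# `FeketeSOS.FeketeSOSHard` (stmt-ValiantsHypothesis-3996), line `Sketch` — the stub `stub_ordSparsitySum` is FALSE

Negative lemma for the lead's registered skeleton of line `Sketch` (cards euler-multiplicity-tau ⊕ witt-zero-carry):
the order–sparsity inequality for SUMS of sparse products in characteristic `p` ("additive Hajós", conjecture OS of
`Cruxes/FeketeSOSHard/SketchIdeator2.lean`, registered as `stub_ordSparsitySum : ∃ C, OrdSparsitySum C`) fails for
every constant `C`, by the SOCLE TILING found by the crux-triage panel (TRIAGE-r1-1, TRIAGE-r1-2): over a field of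
characteristic `p`,
`Σ_{m<p} X^m = (X - 1)^{p-1}`  and  `Σ_{m<p} X^m = (Σ_{i<a} X^i)·(Σ_{j<b} X^{aj}) + X^{ab}·(Σ_{i<c} X^i)`  (`p = ab + c`,
`a = ⌊√p⌋`, `1 ≤ c < a`), a sum of TWO products of polynomials of degree `< p`, non-zero modulo `X^p - 1` (degree `p - 1`),
vanishing at `X = 1` to order `p - 1` with support-sum `a + b + 1 + c ≤ 3√p + 2`.  So `ord₁ ≈ (support-sum)²/9`: the
Koiran–Skomra `t²` is attained in characteristic `p` at the socle, and no inequality `ord₁ ≤ C·T` (nor `≤ C r^a T^{2-η}`)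
holds for sums of `r ≥ 2` sparse products.  Engines: Frobenius (`sub_pow_char`) and the digit decomposition of `range (a*b)` (as in the disprover's `sum_range_mul_eq`).
Mathlib-only imports (deliberately independent of the route file). [folklore]
-/

namespace Summit.ValiantsHypothesis.ValiantsHypothesis.Theorems.FeketeSOSHard.Negative.SketchStubs

open Polynomial Finset

-- `Summit.ValiantsHypothesis.ValiantsHypothesis.…` is the tree's mandated single-conjunct layout (Sub = Summit).
set_option linter.dupNamespace false

noncomputable section

variable {k : Type} [Field k]

/-- **`Σ_{m<p} X^m = (X - 1)^{p-1}`** in characteristic `p` (Frobenius `(X-1)^p = X^p - 1` and the telescoping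
`(Σ_{m<p} X^m)(X-1) = X^p - 1`).  (Adapted from the sibling line's `FeketeNoSparseSplitCyclic.fmo_geom_sum_eq`, whose
module is not yet built on the farm snapshot.) [folklore] -/
theorem socle_geom_sum_eq (p : ℕ) [Fact p.Prime] [CharP k p] :
    (∑ m ∈ range p, (X : k[X]) ^ m) = (X - C 1) ^ (p - 1) := by
  have hp : p.Prime := Fact.out
  have hfrob : (X - C (1 : k)) ^ p = X ^ p - 1 := by
    rw [sub_pow_char, ← C_pow, one_pow, C_1]
  apply mul_right_cancel₀ (X_sub_C_ne_zero (1 : k))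
  rw [← pow_succ, Nat.sub_add_cancel hp.one_le, hfrob, C_1, geom_sum_mul]

/-- Digit decomposition of `range (a*b)`: `m = i + a j`, `i < a`, `j < b` (copy of the disprover's
`FeketeSOSHard.Negative.sum_range_mul_eq`, kept local so that this file imports Mathlib only). -/
theorem socle_sum_range_mul_eq {M : Type*} [AddCommMonoid M] (f : ℕ → M) (a b : ℕ) :
    ∑ m ∈ range (a * b), f m = ∑ j ∈ range b, ∑ i ∈ range a, f (i + a * j) := by
  induction b with
  | zero => simp
  | succ b ih =>
    rw [Nat.mul_succ, sum_range_add, ih, sum_range_succ]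
    congr 1
    exact sum_congr rfl fun i _ => by rw [add_comm]

/-- **Socle tiling**: `Σ_{m < ab+c} X^m = [a]_X · Σ_{j<b} X^{aj} + X^{ab}·[c]_X`. [folklore] -/
theorem socle_sum_eq (a b c : ℕ) :
    (∑ j, (![∑ i ∈ range a, X ^ i, X ^ (a * b)] : Fin 2 → k[X]) j * (![∑ j ∈ range b, X ^ (a * j), ∑ i ∈ range c, X ^ i] : Fin 2 → k[X]) j) = ∑ m ∈ range (a * b + c), (X : k[X]) ^ m := by
  simp only [Fin.sum_univ_two, Matrix.cons_val_zero, Matrix.cons_val_one]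
  rw [sum_range_add, sum_mul_sum, socle_sum_range_mul_eq, mul_sum, sum_comm]
  refine congrArg₂ (· + ·) (sum_congr rfl fun j _ => sum_congr rfl fun i _ => ?_)
    (sum_congr rfl fun i _ => ?_)
  · rw [← pow_add]
  · rw [← pow_add]

/-- A sum of `|s|` monomials over `k` has at most `|s|` terms. -/
theorem card_support_sum_X_pow_le' {ι : Type*} (s : Finset ι) (e : ι → ℕ) :
    (∑ i ∈ s, (X : k[X]) ^ e i).support.card ≤ s.card := by
  classical
  induction s using Finset.induction_on with
  | empty => simp
  | @insert a s ha ih =>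
    rw [sum_insert ha, card_insert_of_notMem ha]
    calc ((X : k[X]) ^ e a + ∑ i ∈ s, X ^ e i).support.card
        ≤ (((X : k[X]) ^ e a).support ∪ (∑ i ∈ s, (X : k[X]) ^ e i).support).card :=
          card_le_card support_add
      _ ≤ ((X : k[X]) ^ e a).support.card + (∑ i ∈ s, (X : k[X]) ^ e i).support.card := card_union_le _ _
      _ ≤ 1 + s.card := by
          have h1 : ((X : k[X]) ^ e a).support.card ≤ 1 := by
            rw [← one_mul (X ^ e a), ← C_1]; exact card_support_C_mul_X_pow_le_one
          omega
      _ = s.card + 1 := by ring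

/-- Support-sum of the socle tiling is at most `a + b + 1 + c`. -/
theorem socle_pairSparsity_le (a b c : ℕ) :
    (∑ j, (((![∑ i ∈ range a, X ^ i, X ^ (a * b)] : Fin 2 → k[X]) j).support.card + ((![∑ j ∈ range b, X ^ (a * j), ∑ i ∈ range c, X ^ i] : Fin 2 → k[X]) j).support.card)) ≤ a + b + 1 + c := by
  simp only [Fin.sum_univ_two, Matrix.cons_val_zero, Matrix.cons_val_one]
  have h1 : (∑ i ∈ range a, (X : k[X]) ^ i).support.card ≤ a := by
    simpa using card_support_sum_X_pow_le' (k := k) (range a) id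
  have h2 : (∑ j ∈ range b, (X : k[X]) ^ (a * j)).support.card ≤ b := by
    simpa using card_support_sum_X_pow_le' (k := k) (range b) (fun j => a * j)
  have h3 : ((X : k[X]) ^ (a * b)).support.card ≤ 1 := by
    rw [← one_mul (X ^ (a * b)), ← C_1]; exact card_support_C_mul_X_pow_le_one
  have h4 : (∑ i ∈ range c, (X : k[X]) ^ i).support.card ≤ c := by
    simpa using card_support_sum_X_pow_le' (k := k) (range c) id
  omega

/-- Degrees of the socle factors are `< p` when `p = ab + c` with `1 ≤ a`, `1 ≤ b` and `1 ≤ c`. -/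
theorem socle_natDegree_lt (a b c p : ℕ) (hp : p = a * b + c) (ha : 1 ≤ a) (hb : 1 ≤ b) (hc : 1 ≤ c) :
    ∀ j, ((![∑ i ∈ range a, X ^ i, X ^ (a * b)] : Fin 2 → k[X]) j).natDegree < p ∧ ((![∑ j ∈ range b, X ^ (a * j), ∑ i ∈ range c, X ^ i] : Fin 2 → k[X]) j).natDegree < p := by
  have hdegsum : ∀ (n : ℕ) (e : ℕ → ℕ) (D : ℕ), (∀ i < n, e i ≤ D) →
      (∑ i ∈ range n, (X : k[X]) ^ e i).natDegree ≤ D := fun n e D h =>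
    natDegree_sum_le_of_forall_le _ _ fun i hi => (natDegree_X_pow_le _).trans (h i (mem_range.mp hi))
  intro j
  fin_cases j
  · simp only [Fin.zero_eta, Matrix.cons_val_zero]
    constructor
    · refine lt_of_le_of_lt (hdegsum a id (a - 1) fun i hi => by simp; omega) ?_
      have : a ≤ a * b + c := by nlinarith
      omega
    · refine lt_of_le_of_lt (hdegsum b (fun j => a * j) (a * b - a) fun i hi => ?_) (by omega)
      have : a * i + a ≤ a * b := by nlinarith
      omega
  · simp only [Fin.mk_one, Matrix.cons_val_one, Matrix.cons_val_zero]
    constructor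
    · exact lt_of_le_of_lt (natDegree_X_pow_le _) (by omega)
    · exact lt_of_le_of_lt (hdegsum c id (c - 1) fun i hi => by simp; omega) (by omega)

/-- **The socle tiling has order `p - 1` at `X = 1`** in characteristic `p`: its sum is `(X - 1)^{p-1}`. -/
theorem socle_sum_eq_pow (p : ℕ) [Fact p.Prime] [CharP k p] (a b c : ℕ) (hp : p = a * b + c) :
    (∑ j, (![∑ i ∈ range a, X ^ i, X ^ (a * b)] : Fin 2 → k[X]) j * (![∑ j ∈ range b, X ^ (a * j), ∑ i ∈ range c, X ^ i] : Fin 2 → k[X]) j) = (X - 1 : k[X]) ^ (p - 1) := by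
  rw [socle_sum_eq, ← hp, socle_geom_sum_eq p, C_1]

/-- The socle tiling is not divisible by `X^p - 1` (it is monic of degree `p - 1`). -/
theorem not_dvd_socle_sum (p : ℕ) [Fact p.Prime] [CharP k p] (a b c : ℕ) (hp : p = a * b + c) :
    ¬ ((X : k[X]) ^ p - 1 ∣ ∑ j, (![∑ i ∈ range a, X ^ i, X ^ (a * b)] : Fin 2 → k[X]) j * (![∑ j ∈ range b, X ^ (a * j), ∑ i ∈ range c, X ^ i] : Fin 2 → k[X]) j) := by
  rw [socle_sum_eq_pow p a b c hp]
  intro h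
  have hne : (X - 1 : k[X]) ^ (p - 1) ≠ 0 := by rw [← C_1]; exact pow_ne_zero _ (X_sub_C_ne_zero 1)
  have h1 := natDegree_le_of_dvd h hne
  rw [← C_1, natDegree_X_pow_sub_C, natDegree_pow, natDegree_X_sub_C, mul_one] at h1
  have := (Fact.out : p.Prime).pos
  omega

/-- **`stub_ordSparsitySum` is false**: for every constant `κ` there are a prime `p`, the field `ZMod p`, and the socle
tiling `A = ![Σ_{i<a} X^i, X^{ab}]`, `B = ![Σ_{j<b} X^{aj}, Σ_{i<c} X^i]` (`r = 2` products, degrees `< p`, not divisible by `X^p - 1`, `(X-1)^{p-1} ∣` the sum) with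
`κ · (support-sum) < p - 1`.  Any prime `p ≥ (5κ + 6)²` works. [folklore] -/
theorem not_ordSparsitySum (κ : ℕ) :
    ¬ (∀ (k : Type) [Field k] (p : ℕ) [Fact p.Prime] [CharP k p] (r : ℕ) (A B : Fin r → k[X]) (M : ℕ),
      (∀ j, (A j).natDegree < p ∧ (B j).natDegree < p) →
      ¬ ((X : k[X]) ^ p - 1 ∣ ∑ j, A j * B j) →
      (X - 1 : k[X]) ^ M ∣ ∑ j, A j * B j →
      M ≤ κ * ∑ j, ((A j).support.card + (B j).support.card)) := by
  intro hOS
  obtain ⟨p, hp, hprime⟩ := Nat.exists_infinite_primes ((5 * κ + 6) ^ 2)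
  haveI : Fact p.Prime := ⟨hprime⟩
  -- digits: p = a * b + c with a = ⌊√p⌋
  set a := Nat.sqrt p with ha
  set b := p / a with hb
  set c := p % a with hc
  have ha6 : 5 * κ + 6 ≤ a := by rw [ha, Nat.le_sqrt']; exact hp
  have ha1 : 1 ≤ a := by omega
  have hpabc : p = a * b + c := by rw [hb, hc]; exact (Nat.div_add_mod p a).symm
  have hca : c < a := by rw [hc]; exact Nat.mod_lt _ ha1
  have haa : a * a ≤ p := by rw [ha]; exact Nat.sqrt_le p
  have hplt : p < (a + 1) * (a + 1) := by rw [ha]; exact Nat.lt_succ_sqrt p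
  have hap : a < p := by nlinarith
  have hc1 : 1 ≤ c := by
    by_contra h0
    have hc0 : c = 0 := by omega
    have hdvd : a ∣ p := ⟨b, by rw [hpabc, hc0, add_zero]⟩
    rcases (Nat.dvd_prime hprime).mp hdvd with h | h <;> omega
  have hb1 : 1 ≤ b := by
    rw [hb]; exact (Nat.one_le_div_iff (by omega)).mpr hap.le
  have hb_le : b ≤ a + 2 := by
    rw [hb]
    have : p ≤ a * (a + 2) := by nlinarith
    calc p / a ≤ (a * (a + 2)) / a := Nat.div_le_div_right this
      _ = a + 2 := Nat.mul_div_cancel_left _ ha1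
  -- apply OS to the socle tiling over ZMod p
  have key := hOS (ZMod p) p 2 (![∑ i ∈ range a, X ^ i, X ^ (a * b)])
    (![∑ j ∈ range b, X ^ (a * j), ∑ i ∈ range c, X ^ i]) (p - 1)
    (socle_natDegree_lt a b c p hpabc ha1 hb1 hc1) (not_dvd_socle_sum p a b c hpabc)
    (by rw [socle_sum_eq_pow p a b c hpabc])
  have hT := socle_pairSparsity_le (k := ZMod p) a b c
  have h1 : p - 1 ≤ κ * (a + b + 1 + c) := key.trans (Nat.mul_le_mul_left κ hT)
  have h2 : κ * (a + b + 1 + c) ≤ κ * (3 * a + 2) := Nat.mul_le_mul_left κ (by omega)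
  -- but κ (3a + 2) < a² - 1 ≤ p - 1 since a ≥ 5κ + 6
  have h3 : κ * (3 * a + 2) + 2 ≤ a * a := by nlinarith
  omega

end

end Summit.ValiantsHypothesis.ValiantsHypothesis.Theorems.FeketeSOSHard.Negative.SketchStubs
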